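import Literature.Barriers.QuantumFields.AbelianDeconfinementD4Proofs
import Literature.MathematicalPhysics.QuantumFieldTheory.U1WardIdentity
import Literature.MathematicalPhysics.QuantumFieldTheory.LatticeGaugeProofs
import HarnessLib

/-!
# QuantumFields / YangMills — Gauss-law sum rules for Wilson `U(1)₄` (solo seat `solo-QuantumFields-informed`, s18)

**What this is.** Infrastructure for the abelian comparison theory of the summit (`K1`: why the open
conjecture `Literature.Barriers.QuantumFields.AbelianMasslessPhaseD4` — Wilson-action `U(1)₄` has no
exponentially clustering limit state at large `β` — reduces to a single stiffness inequality; the reduction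
itself is `abelianMasslessPhaseD4_of_u1HelicityGapD4` in `SoloInformedU1HelicityGap.lean`). It is NOT a step
towards `YangMills`: the abelian theory is the control case every group-blind technique must fail on
(`AbelianMasslessPhaseD4.not_groupBlindClusteringD4`), and this file makes the mechanism of that failure —
Gauss's law — quantitative and kernel-checked.

**What is proved** (no facts, no axioms beyond the standard ones, no `sorry`), for every infinite-volume limit
state `μ ∈ infiniteVolumeLimitPoints (d := 4) u1Rep β` of the periodic Wilson `U(1)₄` states and the electric
two–plaquette function `G_μ(y; i, j) := ∫ sin θ_{(0;0,1)} · sin θ_{(y;i,j)} dμ` (`plaqCorr`):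
* `integral_comp_configShift`: limit states are translation invariant on bounded continuous cylinder observables;
  hence `∫ sin θ_{(x;0,1)} sin θ_{(y;i,j)} dμ = G_μ(y − x; i, j)` (`integral_u1PlaqIm_mul`).
* `ward_unit_square`: the unit-square instance of the tree's linking Ward identity
  `u1_linking_ward_identity` (surface `{(z;0,1)}`, loop = the plaquette `(0;0,1)`), with the boundary charge of a
  single plaquette computed in closed form (`zdPlaqCharge_single`):
  `([z = e₀] − [z = 0]) ⟨cos θ_p⟩ = β (G(z−e₀;0,1) − G(z;0,1) + G(z;1,2) − G(z−e₂;1,2) + G(z;1,3) − G(z−e₃;1,3))`.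
* `beta_mul_slabSum` (**slab / Gauss-law sum rule**): if `G(·;0,1)`, `G(·;1,2)`, `G(·;1,3)` are summable then for
  every `t ∈ ℤ`, `β ∑_{u : u₀ = t} G(u;0,1) = [t = 0] ⟨cos θ_p⟩` — summing the Ward identities against the
  half-space weight `𝟙{t < z₀}` telescopes the `e₀`-differences onto the slab `z₀ = t` and kills the transverse ones.
* `beta_mul_tsum_plaqCorr` (**susceptibility sum rule**): under the same summability,
  `β ∑_{u ∈ ℤ⁴} G(u;0,1) = ⟨cos θ_p⟩`.
* `summable_plaqCorr_of_clustering`: exponential clustering of bounded measurable gauge-invariant local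
  observables in `μ` (the property negated by `AbelianMasslessPhaseD4`) makes every `G_μ(·; i, j)` summable.

Sources: the Ward identity is the tree's (`U1WardIdentity.lean`, after Fröhlich–Spencer, Comm. Math. Phys. 83
(1982) 411, §2); the sum rules are the lattice form of Gauss's law for the electric flux through a transverse
hyperplane (Guth, Phys. Rev. D 21 (1980) 2291; Fröhlich–Spencer loc. cit. p. 433 fn. 3).
-/

noncomputable section

open MeasureTheory Filter Topology ProbabilityTheory Finset
open Literature.Probability.LatticeModels hiding configShift configShift_apply
open Literature.MathematicalPhysics.QuantumLattice
open Literature.MathematicalPhysics.QuantumFieldTheory hiding IsLocalObservable Site ZdEdge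
open Literature.MathematicalPhysics.QuantumFieldTheory.AreaLaw
open Literature.Barriers.QuantumFields

namespace Summit.QuantumFields.YangMills.Theorems

namespace U1Helicity

variable {d : ℕ}

/-! ### Translation invariance of limit states -/

/-- Infinite-volume limit states of the torus Wilson states are translation invariant on bounded
continuous cylinder observables (the torus states are, and the periodic lift intertwines the
translations). -/
theorem integral_comp_configShift {β : ℝ} {μ : Measure (LGConfig d Circle)}
    (hμ : μ ∈ infiniteVolumeLimitPoints (d := d) u1Rep β) {F : LGConfig d Circle → ℝ}
    {S : Finset (ZdEdge d)} (hFS : IsCylinder F S) (hFc : Continuous F)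
    (hFb : ∃ C, ∀ U, |F U| ≤ C) (v : Literature.Probability.LatticeModels.Site d) :
    ∫ U, F (configShift v U) ∂μ = ∫ U, F U ∂μ := by
  obtain ⟨φ, -, -, hconv⟩ := hμ
  have h1 := hconv (F ∘ configShift v) _ (IsCylinder.comp_configShift hFS v)
    (hFc.comp (continuous_configShift v)) (by obtain ⟨C, hC⟩ := hFb; exact ⟨C, fun U => hC _⟩)
  have hE : ∀ L : ℕ, wilsonExpectation (L := L + 1) u1Rep β
      (toTorusObservable (L + 1) (F ∘ configShift v)) =
      wilsonExpectation (L := L + 1) u1Rep β (toTorusObservable (L + 1) F) := fun L => by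
    rw [toTorusObservable_comp_configShift, wilsonExpectation_comp_torusConfigShift]
  simp only [hE, Function.comp_apply] at h1
  exact tendsto_nhds_unique h1 (hconv F S hFS hFc hFb)

/-- `sin θ_{(y;i,j)} ∘ θ_v = sin θ_{(y-v;i,j)}`. -/
theorem u1PlaqIm_configShift (v y : Literature.Probability.LatticeModels.Site d) (i j : Fin d)
    (U : LGConfig d Circle) : u1PlaqIm y i j (configShift v U) = u1PlaqIm (y - v) i j U := by
  simp only [u1PlaqIm, ZdGaugeConfig.plaquette, configShift_apply, add_sub_right_comm]

/-- The `1 × 1` rectangular holonomy is the plaquette holonomy. -/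
theorem rectangle_one_one {G : Type*} [Group G] (U : LGConfig d G)
    (x : Literature.Probability.LatticeModels.Site d) (i j : Fin d) :
    ZdGaugeConfig.rectangle U x i j 1 1 = ZdGaugeConfig.plaquette U x i j := by
  simp [ZdGaugeConfig.rectangle, ZdGaugeConfig.line, ZdGaugeConfig.plaquette]

/-- The `1 × 1` Wilson loop imaginary part is the plaquette sine. -/
theorem u1LoopIm_one_one (x : Literature.Probability.LatticeModels.Site d) (i j : Fin d)
    (U : LGConfig d Circle) : u1LoopIm x i j 1 1 U = u1PlaqIm x i j U := by
  simp only [u1LoopIm, u1PlaqIm, rectangle_one_one]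

/-- The `1 × 1` Wilson loop real part is the plaquette cosine. -/
theorem u1LoopRe_one_one (x : Literature.Probability.LatticeModels.Site d) (i j : Fin d)
    (U : LGConfig d Circle) :
    u1LoopRe x i j 1 1 U = ((ZdGaugeConfig.plaquette U x i j : Circle) : ℂ).re := by
  simp only [u1LoopRe, rectangle_one_one]

/-- Bounded continuous observables are integrable in a finite measure. -/
theorem integrable_of_continuous {μ : Measure (LGConfig d Circle)} [IsFiniteMeasure μ]
    {F : LGConfig d Circle → ℝ} (hF : Continuous F) {C : ℝ} (hC : ∀ U, |F U| ≤ C) :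
    Integrable F μ :=
  Integrable.of_bound hF.measurable.aestronglyMeasurable C
    (ae_of_all _ fun U => by rw [Real.norm_eq_abs]; exact hC U)

/-- `sin θ_p ∈ L^p(μ)` for every finite measure (it is bounded by `1`). -/
theorem memLp_u1PlaqIm (μ : Measure (LGConfig d Circle)) [IsFiniteMeasure μ]
    (x : Literature.Probability.LatticeModels.Site d) (i j : Fin d) (p : ENNReal) :
    MemLp (u1PlaqIm x i j) p μ :=
  MemLp.of_bound (continuous_u1PlaqIm x i j).measurable.aestronglyMeasurable 1
    (Eventually.of_forall fun U => by rw [Real.norm_eq_abs]; exact abs_u1PlaqIm_le x i j U)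

/-! ### Vocabulary in `d = 4` -/

/-- The unit lattice vectors `e_k`. -/
def e (k : Fin 4) : Literature.Probability.LatticeModels.Site 4 := Pi.single k 1

/-- Coordinates of `e_k`. -/
@[simp] theorem e_apply (k l : Fin 4) : e k l = if l = k then 1 else 0 := by
  simp [e, Pi.single_apply]

/-- The mean plaquette `⟨cos θ_p⟩_μ`. -/
def meanPlaq (μ : Measure (LGConfig 4 Circle)) : ℝ :=
  ∫ U, ((ZdGaugeConfig.plaquette U 0 0 1 : Circle) : ℂ).re ∂μ

/-- The electric two–plaquette function `G_μ(y; i, j) = ⟨sin θ_{(0;0,1)} sin θ_{(y;i,j)}⟩_μ`. -/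
def plaqCorr (μ : Measure (LGConfig 4 Circle)) (y : Literature.Probability.LatticeModels.Site 4)
    (i j : Fin 4) : ℝ :=
  ∫ U, u1PlaqIm 0 0 1 U * u1PlaqIm y i j U ∂μ

variable {β : ℝ} {μ : Measure (LGConfig 4 Circle)}

/-- `⟨sin θ_{(x;0,1)} sin θ_{(y;i,j)}⟩_μ = G_μ(y - x; i, j)` (translation invariance). -/
theorem integral_u1PlaqIm_mul (hμ : μ ∈ infiniteVolumeLimitPoints (d := 4) u1Rep β)
    (x y : Literature.Probability.LatticeModels.Site 4) (i j : Fin 4) :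
    ∫ U, u1PlaqIm x 0 1 U * u1PlaqIm y i j U ∂μ = plaqCorr μ (y - x) i j := by
  have h := integral_comp_configShift hμ
    (F := fun U => u1PlaqIm 0 0 1 U * u1PlaqIm (y - x) i j U)
    (S := Plaq.bonds ((0 : Literature.Probability.LatticeModels.Site 4), (0 : Fin 4), (1 : Fin 4)) ∪
      Plaq.bonds (y - x, i, j))
    (by rw [IsCylinder, Finset.coe_union]
        exact dependsOn_mul (dependsOn_u1PlaqIm _ _ _) (dependsOn_u1PlaqIm _ _ _))
    ((continuous_u1PlaqIm _ _ _).mul (continuous_u1PlaqIm _ _ _))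
    ⟨1, fun U => by
      rw [abs_mul]
      exact mul_le_one₀ (abs_u1PlaqIm_le _ _ _ U) (abs_nonneg _) (abs_u1PlaqIm_le _ _ _ U)⟩ (-x)
  simpa only [plaqCorr, u1PlaqIm_configShift, sub_neg_eq_add, zero_add, sub_add_cancel] using h

/-! ### The Ward identity at the unit square, pierced by one transverse bond -/

/-- Every site lies in the box of radius `max_i |z_i|`. -/
theorem mem_box_sup (z : Literature.Probability.LatticeModels.Site 4) :
    z ∈ box 4 (Finset.univ.sup fun i => (z i).natAbs) := by
  rw [mem_box]; intro i
  have h : (z i).natAbs ≤ Finset.univ.sup fun i => (z i).natAbs :=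
    Finset.le_sup (f := fun i => (z i).natAbs) (Finset.mem_univ i)
  omega

/-- `e_k ≠ 0`. -/
theorem e_ne_zero (k : Fin 4) : e k ≠ 0 := by
  intro h; have := congr_fun h k; simp at this

/-- The plane `(0,1)` as an ordered pair of directions. -/
private abbrev d01 : {q : Fin 4 × Fin 4 // q.1 < q.2} := ⟨(0, 1), by decide⟩
/-- The plane `(1,2)` as an ordered pair of directions. -/
private abbrev d12 : {q : Fin 4 × Fin 4 // q.1 < q.2} := ⟨(1, 2), by decide⟩
/-- The plane `(1,3)` as an ordered pair of directions. -/
private abbrev d13 : {q : Fin 4 × Fin 4 // q.1 < q.2} := ⟨(1, 3), by decide⟩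

/-- The plaquette charges of the single transverse bond `(z, 1)`: `+1/−1` on the two `(0,1)`
plaquettes behind/at `z`, `±1` on the `(1,2)` and `(1,3)` plaquettes at `z` and one step back. -/
theorem zdPlaqCharge_single (z : Literature.Probability.LatticeModels.Site 4) (p : ZdPlaquette 4) :
    (zdPlaqCharge (indicatorCharge {(z, (1 : Fin 4))}) p.1 p.2.1.1 p.2.1.2 : ℝ) =
      ((if p = (z - e 0, d01) then 1 else 0) - (if p = (z, d01) then 1 else 0)) +
      (((if p = (z, d12) then 1 else 0) - (if p = (z - e 2, d12) then 1 else 0)) +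
       ((if p = (z, d13) then 1 else 0) - (if p = (z - e 3, d13) then 1 else 0))) := by
  obtain ⟨y, ⟨i, j⟩, hij⟩ := p
  simp only [zdPlaqCharge, indicatorCharge, Finset.mem_singleton, Prod.mk.injEq, Subtype.mk.injEq,
    e, eq_sub_iff_add_eq]
  fin_cases i <;> fin_cases j <;> simp (config := {decide := true}) at hij ⊢

/-- **The unit-square Ward identity.** For every limit state `μ` of Wilson `U(1)₄` at `β` and
every `z ∈ ℤ⁴`:
`([z = e₀] − [z = 0]) ⟨cos θ_p⟩ = β (G(z−e₀;0,1) − G(z;0,1) + G(z;1,2) − G(z−e₂;1,2) + G(z;1,3) − G(z−e₃;1,3))`. -/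
theorem ward_unit_square (hμ : μ ∈ infiniteVolumeLimitPoints (d := 4) u1Rep β)
    (z : Literature.Probability.LatticeModels.Site 4) :
    ((if z = e 0 then (1 : ℝ) else 0) - (if z = 0 then 1 else 0)) * meanPlaq μ =
      β * ((plaqCorr μ (z - e 0) 0 1 - plaqCorr μ z 0 1) +
        ((plaqCorr μ z 1 2 - plaqCorr μ (z - e 2) 1 2) +
         (plaqCorr μ z 1 3 - plaqCorr μ (z - e 3) 1 3))) := by
  classical
  set K : ℕ := Finset.univ.sup fun i => (z i).natAbs with hK
  have hzK : z ∈ box 4 K := mem_box_sup z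
  have hV : ∀ v ∈ ({(z, (1 : Fin 4))} : Finset (ZdEdge 4)), v.1 ∈ box 4 (K + 1) := by
    intro v hv; rw [Finset.mem_singleton] at hv; subst hv; exact mem_box_succ hzK
  have h1 : ∀ i : Fin 4, (Pi.single i (1 : ℤ) : Literature.Probability.LatticeModels.Site 4) ∈
      box 4 (K + 1) := fun i => by
    simpa using add_single_mem_box_succ (zero_mem_box 4 K) i (Or.inl rfl)
  have hC : ∀ b ∈ loopEdges (0 : Literature.Probability.LatticeModels.Site 4) 0 1 1 1,
      b.1 ∈ box 4 (K + 1) := by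
    intro b hb
    simp only [loopEdges, lineEdges, Finset.mem_union, Finset.mem_insert, Finset.notMem_empty,
      or_false, Nat.cast_one, zero_add] at hb
    rcases hb with ((rfl | rfl) | rfl) | rfl
    · exact zero_mem_box _ _
    · exact h1 0
    · exact h1 1
    · exact zero_mem_box _ _
  have hW := u1_linking_ward_identity hμ hV hC
  -- the left charge
  have h10 : ((1 : Fin 4) = 0) = False := by decide
  have hL : (rectCharge (indicatorCharge {(z, (1 : Fin 4))})
      (0 : Literature.Probability.LatticeModels.Site 4) 0 1 1 1 : ℝ) =
      (if z = e 0 then 1 else 0) - (if z = 0 then 1 else 0) := by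
    simp only [rectCharge, lineCharge, indicatorCharge, Finset.mem_singleton, Prod.mk.injEq,
      Nat.cast_one, zero_add, add_zero, e]
    simp [eq_comm]
  -- membership of the six plaquettes
  have hm : ∀ (y : Literature.Probability.LatticeModels.Site 4) (q : {q : Fin 4 × Fin 4 // q.1 < q.2}),
      y ∈ box 4 (K + 1) → ((y, q) ∈ (box 4 (K + 1 + 1) ×ˢ Finset.univ : Finset (ZdPlaquette 4))) :=
    fun y q hy => Finset.mem_product.2 ⟨mem_box_succ hy, Finset.mem_univ _⟩
  have hz : z ∈ box 4 (K + 1) := mem_box_succ hzK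
  have hze : ∀ k, z - e k ∈ box 4 (K + 1) := fun k => by
    have h : z - e k = z + Pi.single k (-1) := by simp [e, Pi.single_neg, sub_eq_add_neg]
    rw [h]; exact add_single_mem_box_succ hzK k (Or.inr rfl)
  simp only [zdPlaqCharge_single, add_mul, sub_mul, ite_mul, one_mul, zero_mul,
    Finset.sum_add_distrib, Finset.sum_sub_distrib, Finset.sum_ite_eq', hm _ _ hz, hm _ _ (hze _),
    if_true, u1LoopIm_one_one, u1LoopRe_one_one, hL] at hW
  simpa [meanPlaq, plaqCorr, sub_mul] using hW

/-! ### Summing the Ward identities over half-spaces: the slab (Gauss-law) sum rule -/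

/-- The half-space weight `𝟙{t < u₀}`. -/
def hw (t : ℤ) (u : Literature.Probability.LatticeModels.Site 4) : ℝ := if t < u 0 then 1 else 0

/-- `|𝟙{t < u₀}| ≤ 1`. -/
theorem abs_hw_le (t : ℤ) (u : Literature.Probability.LatticeModels.Site 4) : |hw t u| ≤ 1 := by
  unfold hw; split_ifs <;> simp

/-- The discrete `e₀`-derivative of the half-space weight is the slab indicator `𝟙{u₀ = t}`. -/
theorem hw_add_e_zero (t : ℤ) (u : Literature.Probability.LatticeModels.Site 4) :
    hw t (u + e 0) - hw t u = if u 0 = t then 1 else 0 := by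
  simp only [hw, Pi.add_apply, e_apply, if_true]
  split_ifs <;> first | (norm_num; done) | omega

/-- The half-space weight is invariant under transverse unit shifts. -/
theorem hw_add_e_of_ne (t : ℤ) (u : Literature.Probability.LatticeModels.Site 4) {k : Fin 4}
    (hk : k ≠ 0) : hw t (u + e k) = hw t u := by
  simp [hw, Pi.add_apply, e_apply, hk.symm]

/-- A summable family stays summable after multiplication by weights of modulus `≤ 1`. -/
theorem summable_mul_of_abs_le_one {w f : Literature.Probability.LatticeModels.Site 4 → ℝ}
    (hw1 : ∀ u, |w u| ≤ 1) (hf : Summable f) : Summable fun u => w u * f u :=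
  Summable.of_norm_bounded hf.abs fun u => by
    rw [Real.norm_eq_abs, abs_mul]
    exact mul_le_of_le_one_left (abs_nonneg _) (hw1 u)

/-- Summability is invariant under translation of the argument. -/
theorem summable_comp_sub {f : Literature.Probability.LatticeModels.Site 4 → ℝ} (hf : Summable f)
    (v : Literature.Probability.LatticeModels.Site 4) : Summable fun u => f (u - v) :=
  (Equiv.subRight v).summable_iff.2 hf

/-- Reindexing: `∑_u w(u) f(u - v) = ∑_u w(u + v) f(u)`. -/
theorem tsum_hw_mul_comp_sub (t : ℤ) (f : Literature.Probability.LatticeModels.Site 4 → ℝ)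
    (v : Literature.Probability.LatticeModels.Site 4) :
    ∑' u, hw t u * f (u - v) = ∑' u, hw t (u + v) * f u := by
  have h := (Equiv.addRight v).tsum_eq fun u => hw t u * f (u - v)
  simp only [Equiv.coe_addRight, add_sub_cancel_right] at h
  exact h.symm

/-- Discrete Stokes along `e₀`: `∑_u 𝟙{t<u₀} (f(u−e₀) − f(u)) = ∑_{u₀ = t} f(u)`. -/
theorem tsum_hw_mul_sub_e_zero (t : ℤ) {f : Literature.Probability.LatticeModels.Site 4 → ℝ}
    (hf : Summable f) :
    ∑' u, hw t u * (f (u - e 0) - f u) = ∑' u, (if u 0 = t then f u else 0) := by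
  have h1 : Summable fun u => hw t u * f (u - e 0) :=
    summable_mul_of_abs_le_one (abs_hw_le t) (summable_comp_sub hf _)
  have h2 : Summable fun u => hw t u * f u := summable_mul_of_abs_le_one (abs_hw_le t) hf
  have h3 : Summable fun u => hw t (u + e 0) * f u :=
    summable_mul_of_abs_le_one (fun u => abs_hw_le t _) hf
  simp only [mul_sub]
  rw [h1.tsum_sub h2, tsum_hw_mul_comp_sub, ← h3.tsum_sub h2]
  refine tsum_congr fun u => ?_
  rw [← sub_mul, hw_add_e_zero]
  split_ifs <;> simp

/-- Transverse directions do not see the half-space: `∑_u 𝟙{t<u₀} (f(u) − f(u−e_k)) = 0`, `k ≠ 0`. -/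
theorem tsum_hw_mul_sub_e_of_ne (t : ℤ) {f : Literature.Probability.LatticeModels.Site 4 → ℝ}
    (hf : Summable f) {k : Fin 4} (hk : k ≠ 0) :
    ∑' u, hw t u * (f u - f (u - e k)) = 0 := by
  have h1 : Summable fun u => hw t u * f (u - e k) :=
    summable_mul_of_abs_le_one (abs_hw_le t) (summable_comp_sub hf _)
  have h2 : Summable fun u => hw t u * f u := summable_mul_of_abs_le_one (abs_hw_le t) hf
  simp only [mul_sub]
  rw [h2.tsum_sub h1, tsum_hw_mul_comp_sub]
  simp only [hw_add_e_of_ne t _ hk, sub_self]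

/-- **Slab (Gauss-law) sum rule.** For every limit state `μ` of Wilson `U(1)₄` at `β` whose
electric two–plaquette functions `G(·;0,1)`, `G(·;1,2)`, `G(·;1,3)` are summable:
`β ∑_{u : u₀ = t} G(u;0,1) = [t = 0] ⟨cos θ_p⟩` for every `t ∈ ℤ` — the total electric flux
correlation through a transverse hyperplane at distance `t` from the source plaquette vanishes
for `t ≠ 0` and equals `⟨cos θ_p⟩/β` for `t = 0`. -/
theorem beta_mul_slabSum (hμ : μ ∈ infiniteVolumeLimitPoints (d := 4) u1Rep β)
    (h01 : Summable fun y => plaqCorr μ y 0 1) (h12 : Summable fun y => plaqCorr μ y 1 2)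
    (h13 : Summable fun y => plaqCorr μ y 1 3) (t : ℤ) :
    β * ∑' u, (if u 0 = t then plaqCorr μ u 0 1 else 0) = if t = 0 then meanPlaq μ else 0 := by
  classical
  have hW : ∀ z, hw t z * (((if z = e 0 then (1 : ℝ) else 0) - (if z = 0 then 1 else 0)) * meanPlaq μ)
      = β * (hw t z * (plaqCorr μ (z - e 0) 0 1 - plaqCorr μ z 0 1) +
          (hw t z * (plaqCorr μ z 1 2 - plaqCorr μ (z - e 2) 1 2) +
           hw t z * (plaqCorr μ z 1 3 - plaqCorr μ (z - e 3) 1 3))) := fun z => by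
    rw [ward_unit_square hμ z]; ring
  have key : ∑' z, hw t z * (((if z = e 0 then (1 : ℝ) else 0) - (if z = 0 then 1 else 0)) *
      meanPlaq μ) = ∑' z, β * (hw t z * (plaqCorr μ (z - e 0) 0 1 - plaqCorr μ z 0 1) +
          (hw t z * (plaqCorr μ z 1 2 - plaqCorr μ (z - e 2) 1 2) +
           hw t z * (plaqCorr μ z 1 3 - plaqCorr μ (z - e 3) 1 3))) := tsum_congr hW
  -- the left side: a two-point sum
  have hL : ∑' z, hw t z * (((if z = e 0 then (1 : ℝ) else 0) - (if z = 0 then 1 else 0)) *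
      meanPlaq μ) = if t = 0 then meanPlaq μ else 0 := by
    have h0e : (0 : Literature.Probability.LatticeModels.Site 4) ≠ e 0 := (e_ne_zero 0).symm
    rw [tsum_eq_sum (s := {0, e 0}) (fun z hz => by
      simp only [Finset.mem_insert, Finset.mem_singleton, not_or] at hz
      simp [hz.1, hz.2])]
    rw [Finset.sum_pair h0e]
    simp only [hw, e_apply, h0e, (e_ne_zero 0), if_true, if_false, Pi.zero_apply]
    split_ifs <;> first | (norm_num; done) | omega
  -- the right side
  have hs0 : Summable fun z => hw t z * (plaqCorr μ (z - e 0) 0 1 - plaqCorr μ z 0 1) := by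
    simp only [mul_sub]
    exact (summable_mul_of_abs_le_one (abs_hw_le t) (summable_comp_sub h01 _)).sub
      (summable_mul_of_abs_le_one (abs_hw_le t) h01)
  have hs2 : Summable fun z => hw t z * (plaqCorr μ z 1 2 - plaqCorr μ (z - e 2) 1 2) := by
    simp only [mul_sub]
    exact (summable_mul_of_abs_le_one (abs_hw_le t) h12).sub
      (summable_mul_of_abs_le_one (abs_hw_le t) (summable_comp_sub h12 _))
  have hs3 : Summable fun z => hw t z * (plaqCorr μ z 1 3 - plaqCorr μ (z - e 3) 1 3) := by
    simp only [mul_sub]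
    exact (summable_mul_of_abs_le_one (abs_hw_le t) h13).sub
      (summable_mul_of_abs_le_one (abs_hw_le t) (summable_comp_sub h13 _))
  rw [hL, tsum_mul_left, hs0.tsum_add (hs2.add hs3), hs2.tsum_add hs3,
    tsum_hw_mul_sub_e_zero t h01, tsum_hw_mul_sub_e_of_ne t h12 (by decide),
    tsum_hw_mul_sub_e_of_ne t h13 (by decide), add_zero, add_zero] at key
  exact key.symm

/-- **Susceptibility sum rule** `β ∑_{u ∈ ℤ⁴} G(u;0,1) = ⟨cos θ_p⟩` (sum of the slab sum rules
over `t ∈ ℤ`). -/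
theorem beta_mul_tsum_plaqCorr (hμ : μ ∈ infiniteVolumeLimitPoints (d := 4) u1Rep β)
    (h01 : Summable fun y => plaqCorr μ y 0 1) (h12 : Summable fun y => plaqCorr μ y 1 2)
    (h13 : Summable fun y => plaqCorr μ y 1 3) :
    β * ∑' u, plaqCorr μ u 0 1 = meanPlaq μ := by
  classical
  have hfib : HasSum (fun t : ℤ => ∑' u : Literature.Probability.LatticeModels.Site 4,
      (if u 0 = t then plaqCorr μ u 0 1 else 0)) (∑' u, plaqCorr μ u 0 1) := by
    have h := h01.hasSum.tsum_fiberwise fun u : Literature.Probability.LatticeModels.Site 4 => u 0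
    have e1 : ∀ c : ℤ,
        (∑' b : ↥((fun u : Literature.Probability.LatticeModels.Site 4 => u 0) ⁻¹' {c}),
          plaqCorr μ (↑b) 0 1) = ∑' u, if u 0 = c then plaqCorr μ u 0 1 else 0 := fun c => by
      rw [_root_.tsum_subtype ((fun u : Literature.Probability.LatticeModels.Site 4 => u 0) ⁻¹' {c})
        (fun y => plaqCorr μ y 0 1)]
      exact tsum_congr fun u => by simp [Set.indicator_apply]
    simp only [e1] at h
    exact h
  have h2 := hfib.mul_left β
  simp only [beta_mul_slabSum hμ h01 h12 h13] at h2
  exact h2.unique (hasSum_ite_eq 0 (meanPlaq μ))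

/-! ### Exponential clustering makes the electric two–plaquette functions summable -/

/-- Under `IsProbabilityMeasure μ`, `⟨sin θ⟩_μ = 0` and exponential clustering of the local
gauge-invariant observables `sin θ_{(0;0,1)}`, `sin θ_{(0;i,j)}` with some rate `m`, the function
`G_μ(·; i, j)` is summable. -/
theorem summable_plaqCorr_of_clustering (hμ : μ ∈ infiniteVolumeLimitPoints (d := 4) u1Rep β)
    {m : ℝ} (hcl : ∀ F₁ F₂ : LGConfig 4 Circle → ℝ,
      Literature.MathematicalPhysics.QuantumLattice.IsLocalObservable F₁ →
      Literature.MathematicalPhysics.QuantumLattice.IsLocalObservable F₂ →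
      Measurable F₁ → Measurable F₂ → (∃ C, ∀ U, |F₁ U| ≤ C) → (∃ C, ∀ U, |F₂ U| ≤ C) →
      IsZdGaugeInvariant F₁ → IsZdGaugeInvariant F₂ →
        HasExponentialDecayRate
          (fun x : Literature.Probability.LatticeModels.Site 4 =>
            cov[F₁, fun U => F₂ (configShift x U); μ]) m)
    (i j : Fin 4) : Summable fun y => plaqCorr μ y i j := by
  have hprob : IsProbabilityMeasure μ := by obtain ⟨_, _, h, _⟩ := hμ; exact h
  have h := hcl (u1PlaqIm 0 0 1) (u1PlaqIm 0 i j) ⟨_, dependsOn_u1PlaqIm _ _ _⟩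
    ⟨_, dependsOn_u1PlaqIm _ _ _⟩ (continuous_u1PlaqIm _ _ _).measurable
    (continuous_u1PlaqIm _ _ _).measurable ⟨1, abs_u1PlaqIm_le _ _ _⟩ ⟨1, abs_u1PlaqIm_le _ _ _⟩
    (isZdGaugeInvariant_u1PlaqIm _ _ _) (isZdGaugeInvariant_u1PlaqIm _ _ _)
  have hcov : ∀ x : Literature.Probability.LatticeModels.Site 4,
      cov[u1PlaqIm 0 0 1, fun U => u1PlaqIm 0 i j (configShift x U); μ] = plaqCorr μ (-x) i j := by
    intro x
    have h2 : (fun U => u1PlaqIm (0 : Literature.Probability.LatticeModels.Site 4) i j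
        (configShift x U)) = u1PlaqIm (-x) i j := by
      funext U; rw [u1PlaqIm_configShift, zero_sub]
    rw [h2, covariance_eq_sub (memLp_u1PlaqIm μ _ _ _ 2) (memLp_u1PlaqIm μ _ _ _ 2)]
    simp only [Pi.mul_apply, integral_u1PlaqIm_eq_zero hμ, zero_mul, sub_zero, plaqCorr]
  simp only [hcov] at h
  exact (HasExponentialDecayRate.comp_neg (G := fun y => plaqCorr μ y i j) h).summable

end U1Helicity

end Summit.QuantumFields.YangMills.Theorems
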